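import Literature.Geometry.Lorentzian.SpacetimeLocalConvergenceTimeOrientation
import HarnessLib

/-!
# Limits of limits, I: levels, reference balls and indices of the diagonal datum
(topic `Geometry/Lorentzian`; the selections behind `LocalSubconvergence.trans` of
`SpacetimeLocalConvergenceTrans.lean`, Petersen 2006, Ch. 10, §3.2)

Given a subconvergence datum `D₁ : (𝓢ₙ, pₙ) ⇀ (𝓣, t)` (comparison maps `φₙ`) and a subconvergence
datum `D₂ : (𝓣, q'ₘ) ⇀ (𝓤, u)` of translates of the middle spacetime (comparison maps `Fⱼ`):

* `level` (`exists_level`): a strictly increasing reindexing of the exhaustion of `D₂` with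
  `closure (U₂ (level m)) ⊆ U₂ (level (m+1))` and `dF_{level (m+1)}(T_𝓤)` TIMELIKE on
  `closure (U₂ (level m))` (`eventually_isTimelike_mfderiv_embed`, `exists_strictMono_step`).
* `refPoints`, `refRadius`, `refBall` (`exists_refData`): finitely many compact reference chart
  balls per level inside `U₂ (level (m+1))` whose open cores cover `closure (U₂ (level m))`.
* `stageMap m = F_{level (m+1)}`, `stageSet m = closure (U₂ (level m))`, the `firstBracket`
  `(φₙ ∘ F_m ∘ c_p⁻¹)^* gₙ − (F_m ∘ c_p⁻¹)^* g_𝓣`, the requirements `IndexGood m n`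
  ((i) `F_m(C_m) ⊆ U₁ n`, (ii) `d(φₙ ∘ F_m)` orientation-preserving on `C_m`, (iii) first brackets
  `≤ 1/(m+1)` on all reference balls of level `≤ m`), `eventually_indexGood`, and the strictly
  increasing `index` with `IndexGood m (index m)` (`Filter.extraction_forall_of_eventually`).

## References
* [Petersen2006] P. Petersen, *Riemannian Geometry*, 2nd ed., GTM 171, Springer 2006, Ch. 10, §3.2.
-/

noncomputable section

open TopologicalSpace Manifold Filter Topology Set Function Metric Bundle
open scoped ContDiff Topology ENNReal

universe u v w

namespace Literature.Geometry.Lorentzian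

namespace Spacetime

namespace LocalSubconvergence

variable {𝓢ₙ : ℕ → Spacetime.{u} 4} {pₙ : ∀ n, (𝓢ₙ n).carrier} {𝓣 : Spacetime.{v} 4}
  {t : 𝓣.carrier} {k : ℕ} {𝓤 : Spacetime.{w} 4} {q' : ℕ → 𝓣.carrier} {u : 𝓤.carrier}

/-! ### Step A: the levels -/

section Level

variable (D₂ : LocalSubconvergence (fun _ ↦ 𝓣) q' 𝓤 u k)

/-- **Existence of the levels**: a strictly increasing `ρ` with
`closure (U (ρ m)) ⊆ U (ρ (m+1))` and `dF_{ρ (m+1)}(T_𝓤 x)` timelike for `x ∈ closure (U (ρ m))`.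
[cite: Petersen2006, Ch. 10 §3.2] -/
theorem exists_level : ∃ ρ : ℕ → ℕ, StrictMono ρ ∧ ∀ m,
    closure (D₂.U (ρ m) : Set 𝓤.carrier) ⊆ D₂.U (ρ (m + 1)) ∧
      ∀ x ∈ closure (D₂.U (ρ m) : Set 𝓤.carrier), 𝓣.metric.IsTimelike
        (mfderiv (𝓡 4) (𝓡 4) (D₂.embed (ρ (m + 1))) x (𝓤.timeOrientation.vectorField x)) := by
  have h : ∀ i, ∀ᶠ j in atTop, closure (D₂.U i : Set 𝓤.carrier) ⊆ D₂.U j ∧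
      ∀ x ∈ closure (D₂.U i : Set 𝓤.carrier), 𝓣.metric.IsTimelike
        (mfderiv (𝓡 4) (𝓡 4) (D₂.embed j) x (𝓤.timeOrientation.vectorField x)) := fun i ↦
    (D₂.eventually_subset_U (D₂.isCompact_closure_U i)).and
      (D₂.eventually_isTimelike_mfderiv_embed (D₂.isCompact_closure_U i))
  obtain ⟨ρ, hρ, -, hstep⟩ := exists_strictMono_step h 0
  exact ⟨ρ, hρ, hstep⟩

/-- The **levels** `level m` of the diagonal datum (a choice in `exists_level`). [folklore] -/
def level : ℕ → ℕ := Classical.choose D₂.exists_level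

/-- The levels are strictly increasing. [folklore] -/
theorem strictMono_level : StrictMono D₂.level := (Classical.choose_spec D₂.exists_level).1

/-- `closure (U (level m)) ⊆ U (level (m + 1))`. [folklore] -/
theorem closure_U_level_subset (m : ℕ) :
    closure (D₂.U (D₂.level m) : Set 𝓤.carrier) ⊆ D₂.U (D₂.level (m + 1)) :=
  ((Classical.choose_spec D₂.exists_level).2 m).1

/-- `dF_{level (m+1)}(T_𝓤 x)` is timelike for `x ∈ closure (U (level m))`. [folklore] -/
theorem isTimelike_mfderiv_embed_level (m : ℕ) {x : 𝓤.carrier}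
    (hx : x ∈ closure (D₂.U (D₂.level m) : Set 𝓤.carrier)) :
    𝓣.metric.IsTimelike (mfderiv (𝓡 4) (𝓡 4) (D₂.embed (D₂.level (m + 1))) x
      (𝓤.timeOrientation.vectorField x)) :=
  ((Classical.choose_spec D₂.exists_level).2 m).2 x hx

/-- Monotonicity of the level sets. [folklore] -/
theorem U_level_mono {m m' : ℕ} (h : m ≤ m') : D₂.U (D₂.level m) ≤ D₂.U (D₂.level m') :=
  D₂.monotone_U (D₂.strictMono_level.monotone h)

/-- `U (level m) ⊆ U (level (m + 1))` through the closure. [folklore] -/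
theorem U_level_subset_succ (m : ℕ) :
    (D₂.U (D₂.level m) : Set 𝓤.carrier) ⊆ D₂.U (D₂.level (m + 1)) :=
  subset_closure.trans (D₂.closure_U_level_subset m)

/-! ### Step B: reference balls -/

/-- **Reference balls of level `m`**: finitely many chart balls of `𝓤`, compact closed versions in
the chart targets and pulled back inside `U (level (m+1))`, whose open cores cover
`closure (U (level m))`. [folklore] -/
theorem exists_refData (m : ℕ) : ∃ (S : Finset 𝓤.carrier) (r : 𝓤.carrier → ℝ),
    (∀ p ∈ S, 0 < r p ∧ closedBall (chartAt E4 p p) (r p) ⊆ (chartAt E4 p).target ∧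
      (chartAt E4 p).symm '' closedBall (chartAt E4 p p) (r p) ⊆ D₂.U (D₂.level (m + 1))) ∧
    closure (D₂.U (D₂.level m) : Set 𝓤.carrier) ⊆
      ⋃ p ∈ S, (chartAt E4 p).source ∩ chartAt E4 p ⁻¹' ball (chartAt E4 p p) (r p) :=
  𝓤.exists_finset_chartBalls (D₂.U _).isOpen (D₂.isCompact_closure_U _)
    (D₂.closure_U_level_subset m)

/-- The reference points of level `m`. [folklore] -/
def refPoints (m : ℕ) : Finset 𝓤.carrier := Classical.choose (D₂.exists_refData m)

/-- The reference radii of level `m`. [folklore] -/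
def refRadius (m : ℕ) : 𝓤.carrier → ℝ := Classical.choose (Classical.choose_spec (D₂.exists_refData m))

/-- The closed reference ball of the reference point `p` of level `m` (a compact chart piece). [folklore] -/
def refBall (m : ℕ) (p : 𝓤.carrier) : Set E4 := closedBall (chartAt E4 p p) (D₂.refRadius m p)

/-- Properties of the reference balls. [folklore] -/
theorem refBall_spec {m : ℕ} {p : 𝓤.carrier} (hp : p ∈ D₂.refPoints m) :
    0 < D₂.refRadius m p ∧ D₂.refBall m p ⊆ (chartAt E4 p).target ∧
      (chartAt E4 p).symm '' D₂.refBall m p ⊆ D₂.U (D₂.level (m + 1)) :=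
  (Classical.choose_spec (Classical.choose_spec (D₂.exists_refData m))).1 p hp

/-- The open cores of the reference balls of level `m` cover `closure (U (level m))`. [folklore] -/
theorem closure_U_level_subset_refCover (m : ℕ) :
    closure (D₂.U (D₂.level m) : Set 𝓤.carrier) ⊆ ⋃ p ∈ D₂.refPoints m,
      (chartAt E4 p).source ∩ chartAt E4 p ⁻¹' ball (chartAt E4 p p) (D₂.refRadius m p) :=
  (Classical.choose_spec (Classical.choose_spec (D₂.exists_refData m))).2

/-- The reference balls are compact. [folklore] -/
theorem isCompact_refBall (m : ℕ) (p : 𝓤.carrier) : IsCompact (D₂.refBall m p) :=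
  isCompact_closedBall _ _

end Level

/-! ### Step C: the indices -/

section Index

variable (D₁ : LocalSubconvergence 𝓢ₙ pₙ 𝓣 t k) (D₂ : LocalSubconvergence (fun _ ↦ 𝓣) q' 𝓤 u k)

/-- The intermediate map of stage `m`: `F_m = F_{level (m+1)}`. [folklore] -/
def stageMap (m : ℕ) : 𝓤.carrier → 𝓣.carrier := D₂.embed (D₂.level (m + 1))

/-- The compact set of stage `m`: `C_m = closure (U (level m))`. [folklore] -/
def stageSet (m : ℕ) : Set 𝓤.carrier := closure (D₂.U (D₂.level m) : Set 𝓤.carrier)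

/-- The **first bracket** of stage `m` at index `n` in the chart of `𝓤` at `p`:
`(φₙ ∘ F_m ∘ c_p⁻¹)^* gₙ − (F_m ∘ c_p⁻¹)^* g_𝓣`. [folklore] -/
def firstBracket (n m : ℕ) (p : 𝓤.carrier) : E4 → E4 →L[ℝ] E4 →L[ℝ] ℝ :=
  (𝓢ₙ (D₁.sub n)).metricInCoords ((D₁.embed n ∘ D₂.stageMap m) ∘ (chartAt E4 p).symm) -
    𝓣.metricInCoords (D₂.stageMap m ∘ (chartAt E4 p).symm)

/-- The three requirements on the index of stage `m`. [folklore] -/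
def IndexGood (m n : ℕ) : Prop :=
  D₂.stageMap m '' D₂.stageSet m ⊆ D₁.U n ∧
    (∀ x ∈ D₂.stageSet m, (𝓢ₙ (D₁.sub n)).timeOrientation.IsFutureDirected
      (mfderiv (𝓡 4) (𝓡 4) (D₁.embed n ∘ D₂.stageMap m) x (𝓤.timeOrientation.vectorField x))) ∧
    ∀ m₀ ∈ Finset.range (m + 1), ∀ p ∈ D₂.refPoints m₀,
      supCkENorm (D₂.refBall m₀ p) k (firstBracket D₁ D₂ n m p) ≤ ((m + 1 : ℕ) : ℝ≥0∞)⁻¹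

/-- The stage sets are compact. [folklore] -/
theorem isCompact_stageSet (m : ℕ) : IsCompact (D₂.stageSet m) := D₂.isCompact_closure_U _

/-- The stage map is `C^∞` on `U (level (m+1)) ⊇ C_m`. [folklore] -/
theorem contMDiffOn_stageMap (m : ℕ) :
    ContMDiffOn (𝓡 4) (𝓡 4) ∞ (D₂.stageMap m) (D₂.U (D₂.level (m + 1))) :=
  D₂.contMDiffOn_embed _

/-- **Each requirement holds for all large indices.** [cite: Petersen2006, Ch. 10 §3.2] -/
theorem eventually_indexGood (m : ℕ) : ∀ᶠ n in atTop, IndexGood D₁ D₂ m n := by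
  have hCO : D₂.stageSet m ⊆ D₂.U (D₂.level (m + 1)) := D₂.closure_U_level_subset m
  have hFc : ContinuousOn (D₂.stageMap m) (D₂.U (D₂.level (m + 1))) :=
    (D₂.contMDiffOn_stageMap m).continuousOn
  -- (i)
  have h1 : ∀ᶠ n in atTop, D₂.stageMap m '' D₂.stageSet m ⊆ D₁.U n :=
    D₁.eventually_subset_U ((D₂.isCompact_stageSet m).image_of_continuousOn (hFc.mono hCO))
  -- (ii)
  have h2 : ∀ᶠ n in atTop, ∀ x ∈ D₂.stageSet m,
      (𝓢ₙ (D₁.sub n)).timeOrientation.IsFutureDirected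
        (mfderiv (𝓡 4) (𝓡 4) (D₁.embed n ∘ D₂.stageMap m) x
          (𝓤.timeOrientation.vectorField x)) :=
    D₁.eventually_isFutureDirected_mfderiv_comp (D₂.U _).isOpen (D₂.contMDiffOn_stageMap m)
      (D₂.isCompact_stageSet m) hCO
      (fun x hx ↦ D₂.isFutureDirected_mfderiv_embed _ x (hCO hx))
      (fun x hx ↦ D₂.isTimelike_mfderiv_embed_level m hx)
  -- (iii)
  have h3 : ∀ᶠ n in atTop, ∀ m₀ ∈ Finset.range (m + 1), ∀ p ∈ D₂.refPoints m₀,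
      supCkENorm (D₂.refBall m₀ p) k (firstBracket D₁ D₂ n m p) ≤ ((m + 1 : ℕ) : ℝ≥0∞)⁻¹ := by
    refine (eventually_all_finset _).2 fun m₀ hm₀ ↦ (eventually_all_finset _).2 fun p hp ↦ ?_
    have hm₀' : m₀ + 1 ≤ m + 1 := Nat.succ_le_succ (Nat.lt_succ_iff.1 (Finset.mem_range.1 hm₀))
    obtain ⟨-, hBt, hBU⟩ := D₂.refBall_spec hp
    have hKW : MapsTo (chartAt E4 p).symm (D₂.refBall m₀ p) (D₂.U (D₂.level (m + 1))) :=
      fun y hy ↦ D₂.U_level_mono hm₀' (hBU (mem_image_of_mem _ hy))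
    have hlim := D₁.tendsto_supCkENorm_comp_sub (D₂.U _).isOpen (D₂.contMDiffOn_stageMap m) p
      (D₂.isCompact_refBall m₀ p) hBt hKW
    have hpos : (0 : ℝ≥0∞) < ((m + 1 : ℕ) : ℝ≥0∞)⁻¹ :=
      ENNReal.inv_pos.2 (ENNReal.natCast_ne_top _)
    filter_upwards [(tendsto_order.1 hlim).2 _ hpos] with n hn
    exact hn.le
  filter_upwards [h1, h2, h3] with n hn1 hn2 hn3
  exact ⟨hn1, hn2, hn3⟩

/-- **Existence of the indices**: a strictly increasing `ι` with `IndexGood m (ι m)` for all `m`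
(Mathlib `Filter.extraction_forall_of_eventually`). [folklore] -/
theorem exists_index : ∃ ι : ℕ → ℕ, StrictMono ι ∧ ∀ m, IndexGood D₁ D₂ m (ι m) :=
  extraction_forall_of_eventually fun m ↦ eventually_indexGood D₁ D₂ m

/-- The **indices** `index m` of the diagonal datum (a choice in `exists_index`). [folklore] -/
def index : ℕ → ℕ := Classical.choose (exists_index D₁ D₂)

/-- The indices are strictly increasing. [folklore] -/
theorem strictMono_index : StrictMono (index D₁ D₂) := (Classical.choose_spec (exists_index D₁ D₂)).1

/-- The indices are good. [folklore] -/
theorem indexGood_index (m : ℕ) : IndexGood D₁ D₂ m (index D₁ D₂ m) :=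
  (Classical.choose_spec (exists_index D₁ D₂)).2 m

end Index

end LocalSubconvergence

end Spacetime

end Literature.Geometry.Lorentzian
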